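import Summits.BirchSwinnertonDyer.BirchSwinnertonDyer.Theorems.SignedLowerHalvesKobayashiMainConjectureSmallImageRttPairRecords7and11B
import HarnessLib

/-!
# Route `SignedLowerHalves`, crux L `SmallImageLowerHalfBothSigns` (item stmt-BirchSwinnertonDyer-23599), line `rtt_w3` v48:
# PER-PAIR RECORDS at `p = 11` and `p = 7`, part C — the `ε₀ = −1` (ODD-row) twins of Kobayashi's SIGNED MAIN CONJECTURE
# for the five part-B pairs `232544i1`, `465088bc1`, `465088be1 @ 11` and `245456c1`, `353925ce1 @ 7`, BY NAME from P6 + ONE odd row each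

LEAD `cruxlead-stmt-BirchSwinnertonDyer-23599` g19 (director-bsd g27 (1026)(a): «(c) OFFER = GO … lands inside THIS gen or not at all»; the
leftover of the one-shot seat `bsd-line-k3-pairs-p1` g0, its HANDOFF §4 «`ε₀ = −1` twins … NOT done for the five part-B pairs: two-file cap»);
`--supports stmt-BirchSwinnertonDyer-23599 --as helper`; THEOREMS ONLY (no `def`/instance/notation/named fact/`sorry`/`native_decide`);
count-neutral. Companion of part A (`…SmallImageRttPairRecords7and11`, p838585: headline pairs `232544f1 @ 11`, `245456b1 @ 7`, both signs) and
part B (`…7and11B`, p838586: the five pairs below, `ε₀ = +1` from the EVEN row + lower divisibility for both signs), whose §1 kernel data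
(`classX7_frobeniusTrace_not_hasCM_c<label>_<p>`: class X7, `a_p = 0`, non-CM, from Cremona's minimal model and the landed point counts) this
file REUSES by import — nothing is re-decided here.

HONEST STATUS. Every ★ theorem below is a PER-PAIR CONDITIONAL RECORD: the FULL signed main conjecture `KobayashiMainConjecture W p (−1)`
(certified sign `ε₀ = −1`, Kobayashi's minus Selmer group; with part B the pair then has the signed main conjecture for BOTH signs), for THIS
curve at THIS `p`, modulo (i) the 22 typed print facts of crux L's cite stub (hypotheses `hJ … hRes` of P6's
`SmallImageRttLine.kobayashiMainConjecture_of_prints_of_oneSignFloorAt`, file `…RttLineClosing`, p836246; TYPED ≠ PROVED), (ii) ONE displayed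
two-engine Mazur–Tate row `hrowO` of the pair at the ODD layer (table level `2` = Pollack index `1`, `q = deg ω₁⁺ = 0`), and (iii) ONE displayed
image datum `hNS : ¬ Surj W p` (option (b1): mod-`p` image = normaliser of a non-split Cartan, a non-CM rational point of `X_ns⁺(p)`; no
partner-free certificate for it in the tree at `p ∈ {7, 11}`; Zywina's `J₇` criterion / Chen–Cummins' `X_ns⁺(11)` table are NOT typed here).
Closes NOTHING class-wide: item 23599, crux L (class-wide, all `p`), crux M and BSD remain OPEN; BSD is proved for NO curve by this file.

COMPOSITION, all BY NAME, exactly as the `ε₀ = −1` twins of part A: P6's `kobayashiMainConjecture_of_prints_of_oneSignFloorAt (22 prints) W p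
hp2 hX hCM hap hNS (−1) hfl` with the one-sign certificate `hfl` := `SmallImageRttOneSided.oneSignFloor_of_mazurTateRowOdd W p hp2 hgood hap
(Odd 1) hrowO` (file `…RttFloorCert` §2, IMAGE-FREE, PARTNER-FREE: Pollack 2003 Prop. 6.9/6.10/6.18 turn the odd row into `(μ, λ)(L⁻_p) = (0, l)`,
Cor. 5.11 gives `L⁻_p ≠ 0`, hence unit content of Kobayashi's `L_p^{−}` = the tree's `kobayashiL (−1)`).

SOURCE OF THE ROWS (displayed, not kernel): the crux's standing disprover's kit j335262 (`cdisprove-stmt-BirchSwinnertonDyer-23599` g0, PREREG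
`gvkan2` 839c353487edc3e8; table of record `pub/bsd-ssimc/cdisprove-stmt-BirchSwinnertonDyer-23599/gvkan2/LAYERS.tsv` sha16 09c04126f37ca31c,
re-hashed by the LEAD 2026-09-01), TWO engines per row, status `2eng`, 0 disagreements in `(μ, λ)`: engine B = `msengine` (numerical modular
symbols + integrality certificate, `symbols_ok = True`) + `iwlayer`, engine E = `eclib` exact modular symbols. The five odd rows used (columns
`key n pi parity q B_mu B_lam E_mu E_lam status mu lam lmq`): `232544i1@11 2 1 odd 0 0 2 0 2 2eng 0 2 2` · `465088bc1@11 2 1 odd 0 0 0 0 0 2eng 0 0 0` ·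
`465088be1@11 2 1 odd 0 0 0 0 0 2eng 0 0 0` · `245456c1@7 2 1 odd 0 0 2 0 2 2eng 0 2 2` · `353925ce1@7 2 1 odd 0 0 2 0 2 2eng 0 2 2`. Table level `n` ↦
Pollack index `n − 1`; normalisation: the engines use Cremona's `Ω`, the tree's `mazurTateElement` uses `plusPeriod f`; the `∃ Θ`-form of `hrowO`
(`Θ ≠ 0`, `μ`, `λ`) is invariant under the `p`-adic-unit period ratio, which at good `p ≥ 5` is the tree theorem `realPeriodRat_eq_unit_mul_plusPeriod_holds`.

References: [Kobayashi2003] Conjecture (p. 2), Thm. 1.2, 4.1, 7.4; [Pollack2003] Prop. 6.9, 6.10, 6.18, Cor. 5.11, Conj. 6.3;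
[PollackWeston2011MT] §3.1, Thm. 4.1; [Cremona2006] Table 1 (labels 232544i1, 465088bc1, 465088be1, 245456c1, 353925ce1);
[SilvermanAEC2009] VII.5 Prop. 5.1, App. C §11.
-/

set_option autoImplicit false
-- D-0017: single-problem summit, the namespace repeats the problem name by design.
set_option linter.dupNamespace false
noncomputable section

open scoped Classical MatrixGroups ModularForm

open CongruenceSubgroup WeierstrassCurve Literature.NumberTheory.EllipticCurves
  Literature.NumberTheory.EllipticCurves.ModularForms
  Literature.NumberTheory.EllipticCurves.Kobayashi2003 ZpExtension
  Literature.NumberTheory.EllipticCurves.GreenbergVatsal2000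
  Literature.NumberTheory.EllipticCurves.Rank1Residual
  Literature.NumberTheory.EllipticCurves.Rank1Residual.Typed
  Literature.NumberTheory.EllipticCurves.Rank1Residual.X11RankOneCertificates
  Literature.NumberTheory.IwasawaTheory
  Summit.BirchSwinnertonDyer.BirchSwinnertonDyer.Rank1Residual.IntModel
  Summit.BirchSwinnertonDyer.BirchSwinnertonDyer.Rank1Residual.X11RankOne
  Summit.BirchSwinnertonDyer.Rank1Residual.X11b
  Summit.BirchSwinnertonDyer.Rank1Residual.X1
  Summit.BirchSwinnertonDyer.Rank1Residual.X1.MuLambda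
  Summit.BirchSwinnertonDyer.Rank1Residual.Supersingular
  Summit.BirchSwinnertonDyer.BirchSwinnertonDyer.Theorems

namespace Summit.BirchSwinnertonDyer.BirchSwinnertonDyer.Theorems.SmallImageRttLine

/-! ## The five `ε₀ = −1` records (the 22 print facts of crux L's cite stub are the displayed hypotheses `hJ … hRes`, in P6's order) -/

/-- ★ **PER-PAIR CONDITIONAL RECORD — the `ε₀ = −1` twin for `232544i1 @ 11`** (`N = 232544 = 2⁵·13²·43`, Cremona's minimal model `0, 0, 0, -6682520, 39157150032`):
`KobayashiMainConjecture W 11 (−1)` from the 22 prints `hJ … hRes` (typed ≠ proved), the displayed image datum `hNS : ¬ Surj W 11` (option (b1)),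
and ONE displayed ODD two-engine Mazur–Tate row `hrowO` — kit j335262 `gvkan2/LAYERS.tsv` 09c04126f37ca31c, row `232544i1@11, level 2 = Pollack
index 1, odd, q = deg ω₁⁺ = 0`: `μ = 0, λ = 2 = 0 + 2`, engines B (`msengine`+`iwlayer`) and E (`eclib`) AGREE (other rows of the pair:
even index 2: `μ = 0, λ = 12 = 10 + 2`; index 0: `μ = 1`) ⇒ `(μ, λ)(L⁻_11(E)) = (0, 2)`; BY NAME: P6's `kobayashiMainConjecture_of_prints_of_oneSignFloorAt` ∘
`SmallImageRttOneSided.oneSignFloor_of_mazurTateRowOdd`; kernel data := part B's `classX7_frobeniusTrace_not_hasCM_c232544i1_11`.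
Per pair; CONDITIONAL; with part B's `ε₀ = +1` record the pair has the signed main conjecture for both signs; closes nothing class-wide;
23599, crux L, crux M and BSD remain OPEN; BSD is proved for no curve. [cite: Kobayashi2003, Conjecture (p. 2), Thm. 1.2, Thm. 4.1]
[cite: Pollack2003, Prop. 6.18, Cor. 5.11] [cite: Cremona2006, Table 1 (Cremona label 232544i1)] -/
theorem kobayashiMainConjecture_c232544i1_11_neg_one_of_prints_of_mazurTateRow
    (hJ : thm62_63_73_signedColemanKato_zetaJoint) (h12 : thm12_signedSelmerDual_finite_torsion) (h41 : thm41_signedCharIdeal_divisibility)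
    (hD : Hida2000_thm326_exists_galoisRep) (hC : Carayol1986_artinConductorExponent)
    (hS : ∀ (V : WeierstrassCurve ℚ) (ℓ : ℕ) [Fact ℓ.Prime], V.swanConductorAt_rationalTate_eq_wildConductorExponent_of_ringChar_eq_two ℓ)
    (hmod : exists_isNewformOf) (hKim : BDKim2009.cor213_signedLambda_add_sum_delta_eq_of_torsionIso)
    (hPR : PollackRubin2004.mainTheorem_signedCharIdeal_eq_of_cm) (hV : vatsal1999_plusSymbol_congruence)
    (hK211 : BDKim2009.prop211_selmer_noFiniteSubmodule) (hK2526 : BDKim2009.cor25_prop26_selmer_lambda_eq_add_sum_delta)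
    (h53 : Literature.NumberTheory.ComplexMultiplication.EllipticUnits.JohnsonLeungKings2011.cor53_thm52ShapeO) (hKE : Literature.NumberTheory.ComplexMultiplication.EllipticUnits.Kato2004.sec155_exists_katoUnitRep)
    (h24i : Literature.NumberTheory.ComplexMultiplication.EllipticUnits.DeShalit1987.prop24_i_mem_rayClassField) (h24ii : Literature.NumberTheory.ComplexMultiplication.EllipticUnits.DeShalit1987.prop24_ii_galoisAction)
    (h25 : Literature.NumberTheory.ComplexMultiplication.EllipticUnits.DeShalit1987.prop25_i_normRelation)
    (hKP : KimPark2017.prop212_prop33_localSignedDual_free_rank_two) (hKPd : KimPark2017.def210_prop212_exists_signedNormSystem)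
    (hKP29 : KimPark2017.def210_prop29_exists_signedNormSystem_logSum)
    (hF1 : Literature.NumberTheory.EllipticCurves.Kato2004.CM.prop159_ellipticUnits_tatePairing_values_inert)
    (hRes : Literature.NumberTheory.EllipticCurves.ModularForms.Ribet1977_cmNewform_gamma0_badEulerFactor_padicCharacter)
    (W : WeierstrassCurve ℚ) [W.IsElliptic] [W.IsGloballyMinimal] [Fact (Nat.Prime 11)]
    (hW : W = ⟨0, 0, 0, -6682520, 39157150032⟩) (hNS : ¬ W.HasSurjectiveModNGaloisRep 11)
    (hrowO : ∀ [NeZero (W.conductorNorm ℤ)] (f : CuspForm (Gamma0 (W.conductorNorm ℤ)) 2), IsNewformOf W f →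
      ∃ Θ : IwasawaAlgebra 11, iwasawaToPowerSeries 11 Θ =
          ((mazurTateElement f 11 1).map (algebraMap ℚ ℚ_[11]) : PowerSeries ℚ_[11]) ∧
        Θ ≠ 0 ∧ mu Θ = 0 ∧ lam Θ = (cyclotomicOmegaPlus 11 1).natDegree + 2) :
    KobayashiMainConjecture W 11 (-1) := by
  obtain ⟨hX, hap, hcm⟩ := classX7_frobeniusTrace_not_hasCM_c232544i1_11 W hW
  exact kobayashiMainConjecture_of_prints_of_oneSignFloorAt hJ h12 h41 hD hC hS hmod hKim hPR hV hK211 hK2526 h53 hKE h24i h24ii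
    h25 hKP hKPd hKP29 hF1 hRes W 11 (by norm_num) hX hcm hap hNS (-1)
    (fun f hf Lplus Lminus hPP ↦ SmallImageRttOneSided.oneSignFloor_of_mazurTateRowOdd W 11 (by norm_num) hX.1.1 hap
      (by decide : Odd 1) hrowO f hf Lplus Lminus hPP)

/-- ★ **PER-PAIR CONDITIONAL RECORD — the `ε₀ = −1` twin for `465088bc1 @ 11`** (`N = 465088 = 2⁶·13²·43`, Cremona's minimal model `0, 0, 0, -1670630, 4894643754`):
`KobayashiMainConjecture W 11 (−1)` from the 22 prints `hJ … hRes` (typed ≠ proved), the displayed image datum `hNS : ¬ Surj W 11` (option (b1)),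
and ONE displayed ODD two-engine Mazur–Tate row `hrowO` — kit j335262 `gvkan2/LAYERS.tsv` 09c04126f37ca31c, row `465088bc1@11, level 2 = Pollack
index 1, odd, q = deg ω₁⁺ = 0`: `μ = 0, λ = 0 = 0 + 0`, engines B (`msengine`+`iwlayer`) and E (`eclib`) AGREE (other rows of the pair:
even index 2: `μ = 0, λ = 10 = 10 + 0`; index 0: `μ = 0, λ = 0`) ⇒ `(μ, λ)(L⁻_11(E)) = (0, 0)`; BY NAME: P6's `kobayashiMainConjecture_of_prints_of_oneSignFloorAt` ∘
`SmallImageRttOneSided.oneSignFloor_of_mazurTateRowOdd`; kernel data := part B's `classX7_frobeniusTrace_not_hasCM_c465088bc1_11`.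
Per pair; CONDITIONAL; with part B's `ε₀ = +1` record the pair has the signed main conjecture for both signs; closes nothing class-wide;
23599, crux L, crux M and BSD remain OPEN; BSD is proved for no curve. [cite: Kobayashi2003, Conjecture (p. 2), Thm. 1.2, Thm. 4.1]
[cite: Pollack2003, Prop. 6.18, Cor. 5.11] [cite: Cremona2006, Table 1 (Cremona label 465088bc1)] -/
theorem kobayashiMainConjecture_c465088bc1_11_neg_one_of_prints_of_mazurTateRow
    (hJ : thm62_63_73_signedColemanKato_zetaJoint) (h12 : thm12_signedSelmerDual_finite_torsion) (h41 : thm41_signedCharIdeal_divisibility)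
    (hD : Hida2000_thm326_exists_galoisRep) (hC : Carayol1986_artinConductorExponent)
    (hS : ∀ (V : WeierstrassCurve ℚ) (ℓ : ℕ) [Fact ℓ.Prime], V.swanConductorAt_rationalTate_eq_wildConductorExponent_of_ringChar_eq_two ℓ)
    (hmod : exists_isNewformOf) (hKim : BDKim2009.cor213_signedLambda_add_sum_delta_eq_of_torsionIso)
    (hPR : PollackRubin2004.mainTheorem_signedCharIdeal_eq_of_cm) (hV : vatsal1999_plusSymbol_congruence)
    (hK211 : BDKim2009.prop211_selmer_noFiniteSubmodule) (hK2526 : BDKim2009.cor25_prop26_selmer_lambda_eq_add_sum_delta)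
    (h53 : Literature.NumberTheory.ComplexMultiplication.EllipticUnits.JohnsonLeungKings2011.cor53_thm52ShapeO) (hKE : Literature.NumberTheory.ComplexMultiplication.EllipticUnits.Kato2004.sec155_exists_katoUnitRep)
    (h24i : Literature.NumberTheory.ComplexMultiplication.EllipticUnits.DeShalit1987.prop24_i_mem_rayClassField) (h24ii : Literature.NumberTheory.ComplexMultiplication.EllipticUnits.DeShalit1987.prop24_ii_galoisAction)
    (h25 : Literature.NumberTheory.ComplexMultiplication.EllipticUnits.DeShalit1987.prop25_i_normRelation)
    (hKP : KimPark2017.prop212_prop33_localSignedDual_free_rank_two) (hKPd : KimPark2017.def210_prop212_exists_signedNormSystem)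
    (hKP29 : KimPark2017.def210_prop29_exists_signedNormSystem_logSum)
    (hF1 : Literature.NumberTheory.EllipticCurves.Kato2004.CM.prop159_ellipticUnits_tatePairing_values_inert)
    (hRes : Literature.NumberTheory.EllipticCurves.ModularForms.Ribet1977_cmNewform_gamma0_badEulerFactor_padicCharacter)
    (W : WeierstrassCurve ℚ) [W.IsElliptic] [W.IsGloballyMinimal] [Fact (Nat.Prime 11)]
    (hW : W = ⟨0, 0, 0, -1670630, 4894643754⟩) (hNS : ¬ W.HasSurjectiveModNGaloisRep 11)
    (hrowO : ∀ [NeZero (W.conductorNorm ℤ)] (f : CuspForm (Gamma0 (W.conductorNorm ℤ)) 2), IsNewformOf W f →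
      ∃ Θ : IwasawaAlgebra 11, iwasawaToPowerSeries 11 Θ =
          ((mazurTateElement f 11 1).map (algebraMap ℚ ℚ_[11]) : PowerSeries ℚ_[11]) ∧
        Θ ≠ 0 ∧ mu Θ = 0 ∧ lam Θ = (cyclotomicOmegaPlus 11 1).natDegree + 0) :
    KobayashiMainConjecture W 11 (-1) := by
  obtain ⟨hX, hap, hcm⟩ := classX7_frobeniusTrace_not_hasCM_c465088bc1_11 W hW
  exact kobayashiMainConjecture_of_prints_of_oneSignFloorAt hJ h12 h41 hD hC hS hmod hKim hPR hV hK211 hK2526 h53 hKE h24i h24ii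
    h25 hKP hKPd hKP29 hF1 hRes W 11 (by norm_num) hX hcm hap hNS (-1)
    (fun f hf Lplus Lminus hPP ↦ SmallImageRttOneSided.oneSignFloor_of_mazurTateRowOdd W 11 (by norm_num) hX.1.1 hap
      (by decide : Odd 1) hrowO f hf Lplus Lminus hPP)

/-- ★ **PER-PAIR CONDITIONAL RECORD — the `ε₀ = −1` twin for `465088be1 @ 11`** (`N = 465088 = 2⁶·13²·43`, Cremona's minimal model `0, 0, 0, -282336470, 10753532327538`):
`KobayashiMainConjecture W 11 (−1)` from the 22 prints `hJ … hRes` (typed ≠ proved), the displayed image datum `hNS : ¬ Surj W 11` (option (b1)),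
and ONE displayed ODD two-engine Mazur–Tate row `hrowO` — kit j335262 `gvkan2/LAYERS.tsv` 09c04126f37ca31c, row `465088be1@11, level 2 = Pollack
index 1, odd, q = deg ω₁⁺ = 0`: `μ = 0, λ = 0 = 0 + 0`, engines B (`msengine`+`iwlayer`) and E (`eclib`) AGREE (other rows of the pair:
even index 2: `μ = 0, λ = 10 = 10 + 0`; index 0: `μ = 0, λ = 0`) ⇒ `(μ, λ)(L⁻_11(E)) = (0, 0)`; BY NAME: P6's `kobayashiMainConjecture_of_prints_of_oneSignFloorAt` ∘
`SmallImageRttOneSided.oneSignFloor_of_mazurTateRowOdd`; kernel data := part B's `classX7_frobeniusTrace_not_hasCM_c465088be1_11`.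
Per pair; CONDITIONAL; with part B's `ε₀ = +1` record the pair has the signed main conjecture for both signs; closes nothing class-wide;
23599, crux L, crux M and BSD remain OPEN; BSD is proved for no curve. [cite: Kobayashi2003, Conjecture (p. 2), Thm. 1.2, Thm. 4.1]
[cite: Pollack2003, Prop. 6.18, Cor. 5.11] [cite: Cremona2006, Table 1 (Cremona label 465088be1)] -/
theorem kobayashiMainConjecture_c465088be1_11_neg_one_of_prints_of_mazurTateRow
    (hJ : thm62_63_73_signedColemanKato_zetaJoint) (h12 : thm12_signedSelmerDual_finite_torsion) (h41 : thm41_signedCharIdeal_divisibility)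
    (hD : Hida2000_thm326_exists_galoisRep) (hC : Carayol1986_artinConductorExponent)
    (hS : ∀ (V : WeierstrassCurve ℚ) (ℓ : ℕ) [Fact ℓ.Prime], V.swanConductorAt_rationalTate_eq_wildConductorExponent_of_ringChar_eq_two ℓ)
    (hmod : exists_isNewformOf) (hKim : BDKim2009.cor213_signedLambda_add_sum_delta_eq_of_torsionIso)
    (hPR : PollackRubin2004.mainTheorem_signedCharIdeal_eq_of_cm) (hV : vatsal1999_plusSymbol_congruence)
    (hK211 : BDKim2009.prop211_selmer_noFiniteSubmodule) (hK2526 : BDKim2009.cor25_prop26_selmer_lambda_eq_add_sum_delta)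
    (h53 : Literature.NumberTheory.ComplexMultiplication.EllipticUnits.JohnsonLeungKings2011.cor53_thm52ShapeO) (hKE : Literature.NumberTheory.ComplexMultiplication.EllipticUnits.Kato2004.sec155_exists_katoUnitRep)
    (h24i : Literature.NumberTheory.ComplexMultiplication.EllipticUnits.DeShalit1987.prop24_i_mem_rayClassField) (h24ii : Literature.NumberTheory.ComplexMultiplication.EllipticUnits.DeShalit1987.prop24_ii_galoisAction)
    (h25 : Literature.NumberTheory.ComplexMultiplication.EllipticUnits.DeShalit1987.prop25_i_normRelation)
    (hKP : KimPark2017.prop212_prop33_localSignedDual_free_rank_two) (hKPd : KimPark2017.def210_prop212_exists_signedNormSystem)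
    (hKP29 : KimPark2017.def210_prop29_exists_signedNormSystem_logSum)
    (hF1 : Literature.NumberTheory.EllipticCurves.Kato2004.CM.prop159_ellipticUnits_tatePairing_values_inert)
    (hRes : Literature.NumberTheory.EllipticCurves.ModularForms.Ribet1977_cmNewform_gamma0_badEulerFactor_padicCharacter)
    (W : WeierstrassCurve ℚ) [W.IsElliptic] [W.IsGloballyMinimal] [Fact (Nat.Prime 11)]
    (hW : W = ⟨0, 0, 0, -282336470, 10753532327538⟩) (hNS : ¬ W.HasSurjectiveModNGaloisRep 11)
    (hrowO : ∀ [NeZero (W.conductorNorm ℤ)] (f : CuspForm (Gamma0 (W.conductorNorm ℤ)) 2), IsNewformOf W f →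
      ∃ Θ : IwasawaAlgebra 11, iwasawaToPowerSeries 11 Θ =
          ((mazurTateElement f 11 1).map (algebraMap ℚ ℚ_[11]) : PowerSeries ℚ_[11]) ∧
        Θ ≠ 0 ∧ mu Θ = 0 ∧ lam Θ = (cyclotomicOmegaPlus 11 1).natDegree + 0) :
    KobayashiMainConjecture W 11 (-1) := by
  obtain ⟨hX, hap, hcm⟩ := classX7_frobeniusTrace_not_hasCM_c465088be1_11 W hW
  exact kobayashiMainConjecture_of_prints_of_oneSignFloorAt hJ h12 h41 hD hC hS hmod hKim hPR hV hK211 hK2526 h53 hKE h24i h24ii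
    h25 hKP hKPd hKP29 hF1 hRes W 11 (by norm_num) hX hcm hap hNS (-1)
    (fun f hf Lplus Lminus hPP ↦ SmallImageRttOneSided.oneSignFloor_of_mazurTateRowOdd W 11 (by norm_num) hX.1.1 hap
      (by decide : Odd 1) hrowO f hf Lplus Lminus hPP)

/-- ★ **PER-PAIR CONDITIONAL RECORD — the `ε₀ = −1` twin for `245456c1 @ 7`** (`N = 245456 = 2⁴·23²·29`, Cremona's minimal model `0, 1, 0, -162533, -51299309`):
`KobayashiMainConjecture W 7 (−1)` from the 22 prints `hJ … hRes` (typed ≠ proved), the displayed image datum `hNS : ¬ Surj W 7` (option (b1)),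
and ONE displayed ODD two-engine Mazur–Tate row `hrowO` — kit j335262 `gvkan2/LAYERS.tsv` 09c04126f37ca31c, row `245456c1@7, level 2 = Pollack
index 1, odd, q = deg ω₁⁺ = 0`: `μ = 0, λ = 2 = 0 + 2`, engines B (`msengine`+`iwlayer`) and E (`eclib`) AGREE (other rows of the pair:
even index 2: `μ = 0, λ = 8 = 6 + 2`; index 0: `μ = 1`) ⇒ `(μ, λ)(L⁻_7(E)) = (0, 2)`; BY NAME: P6's `kobayashiMainConjecture_of_prints_of_oneSignFloorAt` ∘
`SmallImageRttOneSided.oneSignFloor_of_mazurTateRowOdd`; kernel data := part B's `classX7_frobeniusTrace_not_hasCM_c245456c1_7`.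
Per pair; CONDITIONAL; with part B's `ε₀ = +1` record the pair has the signed main conjecture for both signs; closes nothing class-wide;
23599, crux L, crux M and BSD remain OPEN; BSD is proved for no curve. [cite: Kobayashi2003, Conjecture (p. 2), Thm. 1.2, Thm. 4.1]
[cite: Pollack2003, Prop. 6.18, Cor. 5.11] [cite: Cremona2006, Table 1 (Cremona label 245456c1)] -/
theorem kobayashiMainConjecture_c245456c1_7_neg_one_of_prints_of_mazurTateRow
    (hJ : thm62_63_73_signedColemanKato_zetaJoint) (h12 : thm12_signedSelmerDual_finite_torsion) (h41 : thm41_signedCharIdeal_divisibility)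
    (hD : Hida2000_thm326_exists_galoisRep) (hC : Carayol1986_artinConductorExponent)
    (hS : ∀ (V : WeierstrassCurve ℚ) (ℓ : ℕ) [Fact ℓ.Prime], V.swanConductorAt_rationalTate_eq_wildConductorExponent_of_ringChar_eq_two ℓ)
    (hmod : exists_isNewformOf) (hKim : BDKim2009.cor213_signedLambda_add_sum_delta_eq_of_torsionIso)
    (hPR : PollackRubin2004.mainTheorem_signedCharIdeal_eq_of_cm) (hV : vatsal1999_plusSymbol_congruence)
    (hK211 : BDKim2009.prop211_selmer_noFiniteSubmodule) (hK2526 : BDKim2009.cor25_prop26_selmer_lambda_eq_add_sum_delta)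
    (h53 : Literature.NumberTheory.ComplexMultiplication.EllipticUnits.JohnsonLeungKings2011.cor53_thm52ShapeO) (hKE : Literature.NumberTheory.ComplexMultiplication.EllipticUnits.Kato2004.sec155_exists_katoUnitRep)
    (h24i : Literature.NumberTheory.ComplexMultiplication.EllipticUnits.DeShalit1987.prop24_i_mem_rayClassField) (h24ii : Literature.NumberTheory.ComplexMultiplication.EllipticUnits.DeShalit1987.prop24_ii_galoisAction)
    (h25 : Literature.NumberTheory.ComplexMultiplication.EllipticUnits.DeShalit1987.prop25_i_normRelation)
    (hKP : KimPark2017.prop212_prop33_localSignedDual_free_rank_two) (hKPd : KimPark2017.def210_prop212_exists_signedNormSystem)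
    (hKP29 : KimPark2017.def210_prop29_exists_signedNormSystem_logSum)
    (hF1 : Literature.NumberTheory.EllipticCurves.Kato2004.CM.prop159_ellipticUnits_tatePairing_values_inert)
    (hRes : Literature.NumberTheory.EllipticCurves.ModularForms.Ribet1977_cmNewform_gamma0_badEulerFactor_padicCharacter)
    (W : WeierstrassCurve ℚ) [W.IsElliptic] [W.IsGloballyMinimal] [Fact (Nat.Prime 7)]
    (hW : W = ⟨0, 1, 0, -162533, -51299309⟩) (hNS : ¬ W.HasSurjectiveModNGaloisRep 7)
    (hrowO : ∀ [NeZero (W.conductorNorm ℤ)] (f : CuspForm (Gamma0 (W.conductorNorm ℤ)) 2), IsNewformOf W f →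
      ∃ Θ : IwasawaAlgebra 7, iwasawaToPowerSeries 7 Θ =
          ((mazurTateElement f 7 1).map (algebraMap ℚ ℚ_[7]) : PowerSeries ℚ_[7]) ∧
        Θ ≠ 0 ∧ mu Θ = 0 ∧ lam Θ = (cyclotomicOmegaPlus 7 1).natDegree + 2) :
    KobayashiMainConjecture W 7 (-1) := by
  obtain ⟨hX, hap, hcm⟩ := classX7_frobeniusTrace_not_hasCM_c245456c1_7 W hW
  exact kobayashiMainConjecture_of_prints_of_oneSignFloorAt hJ h12 h41 hD hC hS hmod hKim hPR hV hK211 hK2526 h53 hKE h24i h24ii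
    h25 hKP hKPd hKP29 hF1 hRes W 7 (by norm_num) hX hcm hap hNS (-1)
    (fun f hf Lplus Lminus hPP ↦ SmallImageRttOneSided.oneSignFloor_of_mazurTateRowOdd W 7 (by norm_num) hX.1.1 hap
      (by decide : Odd 1) hrowO f hf Lplus Lminus hPP)

/-- ★ **PER-PAIR CONDITIONAL RECORD — the `ε₀ = −1` twin for `353925ce1 @ 7`** (`N = 353925 = 3²·5²·11²·13`, Cremona's minimal model `0, 0, 1, 147741000, 99524485156`):
`KobayashiMainConjecture W 7 (−1)` from the 22 prints `hJ … hRes` (typed ≠ proved), the displayed image datum `hNS : ¬ Surj W 7` (option (b1)),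
and ONE displayed ODD two-engine Mazur–Tate row `hrowO` — kit j335262 `gvkan2/LAYERS.tsv` 09c04126f37ca31c, row `353925ce1@7, level 2 = Pollack
index 1, odd, q = deg ω₁⁺ = 0`: `μ = 0, λ = 2 = 0 + 2`, engines B (`msengine`+`iwlayer`) and E (`eclib`) AGREE (other rows of the pair:
even index 2: `μ = 0, λ = 8 = 6 + 2`; index 0: `μ = 1`) ⇒ `(μ, λ)(L⁻_7(E)) = (0, 2)`; BY NAME: P6's `kobayashiMainConjecture_of_prints_of_oneSignFloorAt` ∘
`SmallImageRttOneSided.oneSignFloor_of_mazurTateRowOdd`; kernel data := part B's `classX7_frobeniusTrace_not_hasCM_c353925ce1_7`.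
Per pair; CONDITIONAL; with part B's `ε₀ = +1` record the pair has the signed main conjecture for both signs; closes nothing class-wide;
23599, crux L, crux M and BSD remain OPEN; BSD is proved for no curve. [cite: Kobayashi2003, Conjecture (p. 2), Thm. 1.2, Thm. 4.1]
[cite: Pollack2003, Prop. 6.18, Cor. 5.11] [cite: Cremona2006, Table 1 (Cremona label 353925ce1)] -/
theorem kobayashiMainConjecture_c353925ce1_7_neg_one_of_prints_of_mazurTateRow
    (hJ : thm62_63_73_signedColemanKato_zetaJoint) (h12 : thm12_signedSelmerDual_finite_torsion) (h41 : thm41_signedCharIdeal_divisibility)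
    (hD : Hida2000_thm326_exists_galoisRep) (hC : Carayol1986_artinConductorExponent)
    (hS : ∀ (V : WeierstrassCurve ℚ) (ℓ : ℕ) [Fact ℓ.Prime], V.swanConductorAt_rationalTate_eq_wildConductorExponent_of_ringChar_eq_two ℓ)
    (hmod : exists_isNewformOf) (hKim : BDKim2009.cor213_signedLambda_add_sum_delta_eq_of_torsionIso)
    (hPR : PollackRubin2004.mainTheorem_signedCharIdeal_eq_of_cm) (hV : vatsal1999_plusSymbol_congruence)
    (hK211 : BDKim2009.prop211_selmer_noFiniteSubmodule) (hK2526 : BDKim2009.cor25_prop26_selmer_lambda_eq_add_sum_delta)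
    (h53 : Literature.NumberTheory.ComplexMultiplication.EllipticUnits.JohnsonLeungKings2011.cor53_thm52ShapeO) (hKE : Literature.NumberTheory.ComplexMultiplication.EllipticUnits.Kato2004.sec155_exists_katoUnitRep)
    (h24i : Literature.NumberTheory.ComplexMultiplication.EllipticUnits.DeShalit1987.prop24_i_mem_rayClassField) (h24ii : Literature.NumberTheory.ComplexMultiplication.EllipticUnits.DeShalit1987.prop24_ii_galoisAction)
    (h25 : Literature.NumberTheory.ComplexMultiplication.EllipticUnits.DeShalit1987.prop25_i_normRelation)
    (hKP : KimPark2017.prop212_prop33_localSignedDual_free_rank_two) (hKPd : KimPark2017.def210_prop212_exists_signedNormSystem)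
    (hKP29 : KimPark2017.def210_prop29_exists_signedNormSystem_logSum)
    (hF1 : Literature.NumberTheory.EllipticCurves.Kato2004.CM.prop159_ellipticUnits_tatePairing_values_inert)
    (hRes : Literature.NumberTheory.EllipticCurves.ModularForms.Ribet1977_cmNewform_gamma0_badEulerFactor_padicCharacter)
    (W : WeierstrassCurve ℚ) [W.IsElliptic] [W.IsGloballyMinimal] [Fact (Nat.Prime 7)]
    (hW : W = ⟨0, 0, 1, 147741000, 99524485156⟩) (hNS : ¬ W.HasSurjectiveModNGaloisRep 7)
    (hrowO : ∀ [NeZero (W.conductorNorm ℤ)] (f : CuspForm (Gamma0 (W.conductorNorm ℤ)) 2), IsNewformOf W f →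
      ∃ Θ : IwasawaAlgebra 7, iwasawaToPowerSeries 7 Θ =
          ((mazurTateElement f 7 1).map (algebraMap ℚ ℚ_[7]) : PowerSeries ℚ_[7]) ∧
        Θ ≠ 0 ∧ mu Θ = 0 ∧ lam Θ = (cyclotomicOmegaPlus 7 1).natDegree + 2) :
    KobayashiMainConjecture W 7 (-1) := by
  obtain ⟨hX, hap, hcm⟩ := classX7_frobeniusTrace_not_hasCM_c353925ce1_7 W hW
  exact kobayashiMainConjecture_of_prints_of_oneSignFloorAt hJ h12 h41 hD hC hS hmod hKim hPR hV hK211 hK2526 h53 hKE h24i h24ii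
    h25 hKP hKPd hKP29 hF1 hRes W 7 (by norm_num) hX hcm hap hNS (-1)
    (fun f hf Lplus Lminus hPP ↦ SmallImageRttOneSided.oneSignFloor_of_mazurTateRowOdd W 7 (by norm_num) hX.1.1 hap
      (by decide : Odd 1) hrowO f hf Lplus Lminus hPP)

end Summit.BirchSwinnertonDyer.BirchSwinnertonDyer.Theorems.SmallImageRttLine

end
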